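import Literature.AlgebraicGeometry.ModuliOfAbelianVarieties.SiegelFamilyNoetherLefschetzInducedType
import Literature.AlgebraicGeometry.ModuliOfAbelianVarieties.SiegelFamilyHumbertLocusOrbit
import Literature.AlgebraicGeometry.ModuliOfAbelianVarieties.SiegelFamilyHumbertOneProducts
import Literature.AlgebraicGeometry.ModuliOfAbelianVarieties.SiegelFamilyHumbertSurfacesLocallyFinite
import Literature.Geometry.Kaehler.ComplexTorusSubtorusFrameOfSubspace
import Literature.Geometry.Kaehler.ComplexTorusComplementaryAdditionIsogeny
import HarnessLib

/-!
# Genus two: the Noether–Lefschetz locus `NL_{2,(d)}` of the Siegel family is the Humbert surface of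
# discriminant `d²`, and the product locus `𝒜₁ × 𝒜₁ → 𝒜₂` is `H_1(𝔥₂)` (Iribar López 2024, p. 4; Kani 1994;
# Birkenhake–Wilhelm 2003, Prop. 4.8)

Layer `Literature/AlgebraicGeometry/ModuliOfAbelianVarieties`, namespace
`Literature.AlgebraicGeometry.ModuliOfAbelianVarieties.SiegelModuli`; lane `lit-hodgefound` (Track 2 foundations
library, Layer A4), seat `lit-hodgefound-skel-4` (gen 25), row **A4-74** of
`run/shared/lean/pub/lit-hodgefound/SKELETON.md` (§A4-DETAIL), FILE 3 — the genus-two reading of FILE 1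
`SiegelFamilyProductLoci.lean` (`productLocus e`) and FILE 2 `SiegelFamilyNoetherLefschetzInducedType.lean`
(`nlLocusType g δ` = Iribar López's `NL_{g,δ}` on `𝔥_g`) against the lane's Humbert-surface theory of rows
A4-59″/A4-62/A4-64/A4-65/A4-70 (`humbertLocusOfInvariant Δ = H_Δ(𝔥₂)`, `humbertLocusPrim Δ = N_Δ`, Kani's
`N_{δ²} = {X_Z ⊃ an elliptic curve of degree δ}`, Runge's model `π_{k,l}(ℍ × ℍ)`, `diagPoint`, closedness of
`N_Δ`).  THEOREMS ONLY; no definition, no named fact, nothing conditional (D-0026, net debt `0`).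

## Sources, verbatim (materialised pages)

* A. Iribar López, *Noether–Lefschetz cycles on the moduli space of abelian varieties*, Forum Math. Pi (2024)
  [held `paper:arxiv-2411.09910`], §1.2 (p0003 L49–L66): «`NL_{g,δ} = {(A, θ) ∈ 𝒜_g ∣ A has an abelian
  subvariety B and θ|_B is of type δ}` … if `δ = (1,…,1)` (`u` times) then `NL_{g,δ}` is the image of the natural
  product map `𝒜_u × 𝒜_{g−u} → 𝒜_g`»; p0004 L64: «In particular, when `g = 2`, `NL_{g,d}` is the Humbert surface
  of discriminant `d²`, and its class in `CH¹(𝒜₂)` was computed in [vdG82]».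
* Ch. Birkenhake, H. Wilhelm, *Humbert surfaces and the Kummer plane*, Trans. AMS **355** (2003), §4 Prop. 4.8
  (p. 1830): «The Humbert surface `H_{δ²}` is the locus of principally polarized abelian surfaces `(X, L₀) ∈ 𝒜₂`
  admitting an isogeny of degree `δ²`, `(E₁ × E₂, p₁^*𝒪_{E₁}(δ) ⊗ p₂^*𝒪_{E₂}(δ)) → (X, L₀)`»; Prop. 4.5
  (p. 1828: every primitive singular relation is `Sp₄(ℤ)`-equivalent to a normal form).
* E. Kani, *Elliptic curves on abelian surfaces*, Manuscripta Math. **84** (1994) (elliptic curves of degree `δ`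
  and primitive singular relations of invariant `δ²` — the tree's `mem_humbertLocusPrim_sq_iff_exists_ellipticCurve`).
* S. Canning, D. Oprea, R. Pandharipande (2024) [held `paper:arxiv-2408.08718`], §2.2 (p0008 L9–L13): «A
  principally polarized abelian variety `(A,Θ) ∈ 𝒜_g` is decomposable if `(A,Θ) ∈ 𝒜_{g₁} × 𝒜_{g₂}` for some
  `g₁+g₂ = g` with `g_i ≠ 0, g`».

## What is proved (`Z ∈ 𝔥₂`, `X_Z = ℂ²/(Z 1₂)ℤ⁴`, `Φ_Z = prinPeriod Z`, `E_Z = prinForm Z`; `d : ℕ`)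

* §1 MAIN **`nlLocusType_two_eq_humbertLocusPrim_sq`**: `NL_{2,(d)} = N_{d²}` for `0 < d` — «when `g = 2`,
  `NL_{g,d}` is the Humbert surface of discriminant `d²`».  An abelian subvariety `Y ⊂ X_Z` of dimension `1`
  (a complex lattice plane `V`, p36's frame `SubtorusFrame.ofSubspace`) with induced polarization of type `(d)`
  has `|K(E_Z|_Y)| = d²` (p10 `IsSubPolarizationType.natCard_subK`) `= (deg Y)²` (row A4-62 FILE 6
  `natCard_subK_eq_degree_sq`), so `deg Y = d` and `Z ∈ N_{d²}` by Kani (row A4-65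
  `mem_humbertLocusPrim_sq_iff_exists_ellipticCurve`); conversely an elliptic curve of degree `d` is a lattice
  plane whose (unique) type `(d′)` has `d′² = d²`.  Corollaries: `humbertLocusOfInvariant_sq_eq_iUnion_nlLocusType`
  (`H_{d²}(𝔥₂) = ⋃_{m ∣ d} NL_{2,(m)}`, B–W Prop. 4.8 with Kani's degrees `δ′ ∣ δ`), `nlLocusType_two_nonempty`
  (EVERY `NL_{2,(d)}`, `d ≥ 1`, is inhabited — by Runge's model `π_{0,d}(ℍ × ℍ) ⊆ N_{d²}`),
  `isClosed_nlLocusType_two` (row A4-70), `nlLocusType_two_ne_univ`, `nlLocusType_two_eq_empty_iff` (`= ∅ ⟺ d = 0`).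
* §2 THE PRINCIPAL PIECE: **`productLocus_eq_humbertLocusOfInvariant_one`** (the image of `𝒜₁ × 𝒜₁ → 𝒜₂` read
  on `𝔥₂` is `H_1(𝔥₂)`, every splitting `e : Fin 1 ⊕ Fin 1 ≃ Fin 2`), `nlLocusType_two_one_eq_humbertLocusOfInvariant_one`
  (`NL_{2,(1)} = H_1`), `mem_productLocus_iff_exists_smul_apply_eq_zero` (B–W Prop. 4.5: `Z` is in the product
  locus iff some `γ ∈ Sp₄(ℤ)` diagonalises it), `diagPoint_mem_productLocus`,
  **`isPolarizedDecomposable_prinPeriod_iff_mem_humbertLocusOfInvariant_one`** (COP §2.2 at `g = 2`: a principally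
  polarised abelian surface is decomposable — a polarised product of two elliptic curves — iff `Z ∈ H_1(𝔥₂)`),
  `isPolarizedDecomposable_diagPoint`, `humbertLocusOfInvariant_one_ne_univ`.

## Not here

Irreducibility of `H_{d²}` in `𝒜₂`; van der Geer's class `[NL_{2,d}] ∈ CH¹(𝒜₂)`; genus `g ≥ 3`.

## References

* [IribarLopez2024NoetherLefschetzCycles] §1.2 (p. 3), p. 4 (genus two).
* [BirkenhakeWilhelm2003] §4 Prop. 4.5 (p. 1828), Prop. 4.8 (p. 1830).
* [Kani1994EllipticCurvesAbelianSurfaces] (degrees of elliptic curves and singular relations).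
* [CanningOpreaPandharipande2024] §2.2 (p. 8).
* [Lange2023AbelianVarietiesComplex] §1.5.1 (p. 51), §2.4.4 Cor. 2.4.31 (p. 125).
-/

noncomputable section

open Matrix Module Function Set
open scoped Topology

namespace Literature.AlgebraicGeometry.ModuliOfAbelianVarieties

namespace SiegelModuli

open Literature.NumberTheory.Automorphic (siegelUpperHalfSpace)
open Literature.NumberTheory.ModularForms.SiegelUpperHalfSpace
open Literature.Geometry.Kaehler Literature.Geometry.Kaehler.ComplexTorus

/-! ## §1 `NL_{2,(d)} = N_{d²}`: the Humbert surface of discriminant `d²` -/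

section Main

variable (Z : siegelUpperHalfSpace 2)

/-- The lattice plane of an elliptic curve `Y ⊂ X_Z` has rank `2`: `dim_ℝ Φ_Z⁻¹(T_Y) = 2`.
[cite: Lange2023AbelianVarietiesComplex, §1.1.6 Exercise (2)(a) (p. 26)] -/
theorem finrank_comap_realSpan_eq_two (Y : SubtorusFrame (prinPeriod Z) 2) :
    finrank ℝ (Y.realSpan.comap ((prinPeriod Z : (Fin 2 ⊕ Fin 2 → ℝ) ≃L[ℝ] (Fin 2 → ℂ)) :
      (Fin 2 ⊕ Fin 2 → ℝ) →ₗ[ℝ] (Fin 2 → ℂ))) = 2 := by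
  rw [finrank_eq_subRank Y.isLatticeSubspace]
  exact (Y.eq_subRank_of_realSpan_eq_map (prinPeriod Z) _ Y.isLatticeSubspace (realSpan_eq_map_comap Z Y)).symm

/-- **An elliptic curve `Y ⊂ X_Z` of degree `d` is an abelian subvariety with induced polarization of type `(d)`**:
the type `(d′)` of `E_Z|_Y` on `Λ ∩ Φ_Z⁻¹(T_Y)` (it exists, p10) has `d′² = |K(E_Z|_Y)| = (deg Y)² = d²`.
[cite: IribarLopez2024NoetherLefschetzCycles, p. 4 ("when g = 2, NL_{g,d} is the Humbert surface of discriminant d²")]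
[cite: Lange2023AbelianVarietiesComplex, §1.5.1 (p. 51) and §5.3.1 Lemma 5.3.1] -/
theorem isSubPolarizationType_comap_realSpan_of_degree_eq (Y : SubtorusFrame (prinPeriod Z) 2) {d : ℕ}
    (hdeg : (d : ℝ) = -prinForm Z ![latticeVec (prinPeriod Z) (Y.frame 0), latticeVec (prinPeriod Z) (Y.frame 1)]) :
    IsSubPolarizationType (prinPeriod Z : (Fin 2 ⊕ Fin 2 → ℝ) ≃L[ℝ] (Fin 2 → ℂ)) (prinForm Z)
      (Y.realSpan.comap ((prinPeriod Z : (Fin 2 ⊕ Fin 2 → ℝ) ≃L[ℝ] (Fin 2 → ℂ)) :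
        (Fin 2 ⊕ Fin 2 → ℝ) →ₗ[ℝ] (Fin 2 → ℂ))) ![d] := by
  set W := Y.realSpan.comap ((prinPeriod Z : (Fin 2 ⊕ Fin 2 → ℝ) ≃L[ℝ] (Fin 2 → ℂ)) :
    (Fin 2 ⊕ Fin 2 → ℝ) →ₗ[ℝ] (Fin 2 → ℂ)) with hWdef
  have hη := isRiemannForm_prinForm Z
  have hW : IsLatticeSubspace W := Y.isLatticeSubspace
  have hWc : IsComplexSubspace (prinPeriod Z : (Fin 2 ⊕ Fin 2 → ℝ) ≃L[ℝ] (Fin 2 → ℂ)) W := Y.isComplexSubspace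
  obtain ⟨r, d', hd', -⟩ := hη.exists_isSubPolarizationType _ hW hWc
  -- `2r = dim_ℝ W = 2`
  have hr : r = 1 := by
    have h2 := hd'.two_mul_eq_finrank _ hW
    rw [hWdef, finrank_comap_realSpan_eq_two Z Y] at h2
    omega
  subst hr
  -- `|K(E_Z|_Y)| = d′² = (deg Y)² = d²`
  have hK : Nat.card (subK (prinPeriod Z : (Fin 2 ⊕ Fin 2 → ℝ) ≃L[ℝ] (Fin 2 → ℂ)) (prinForm Z) W) = d' 0 ^ 2 := by
    rw [hd'.natCard_subK _ hη hW hWc, Fin.prod_univ_one]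
  have hKdeg := natCard_subK_eq_degree_sq Z Y
  rw [← hWdef, hK, Nat.cast_pow] at hKdeg
  have hsq : (prinForm Z ![latticeVec (prinPeriod Z) (Y.frame 0), latticeVec (prinPeriod Z) (Y.frame 1)]) ^ 2 =
      (d : ℝ) ^ 2 := by
    rw [← neg_sq, ← hdeg]
  have hd0 : d' 0 = d := by
    have h : ((d' 0 : ℝ)) ^ 2 = (d : ℝ) ^ 2 := hKdeg.trans hsq
    exact_mod_cast (pow_left_inj₀ (Nat.cast_nonneg _) (Nat.cast_nonneg _) two_ne_zero).1 h
  have hd'eq : d' = ![d] := by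
    funext i
    fin_cases i
    simpa using hd0
  rw [← hd'eq]
  exact hd'

/-- **An abelian subvariety `Y = π(Φ_Z V) ⊂ X_Z` of dimension `1` with induced polarization of type `(d)` is an
elliptic curve of degree `d`** (a subtorus frame with `Φ_Z⁻¹(T_Y) = V` and `−E_Z(Φλ′₀, Φλ′₁) = d`):
`(deg Y)² = |K(E_Z|_Y)| = d²`. [cite: IribarLopez2024NoetherLefschetzCycles, p. 4]
[cite: Lange2023AbelianVarietiesComplex, §1.5.1 (p. 51) and §5.3.1 Lemma 5.3.1] -/
theorem exists_subtorusFrame_degree_eq_of_isSubPolarizationType {V : Submodule ℝ (Fin 2 ⊕ Fin 2 → ℝ)}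
    (hV : IsLatticeSubspace V) (hVc : IsComplexSubspace (prinPeriod Z : (Fin 2 ⊕ Fin 2 → ℝ) ≃L[ℝ] (Fin 2 → ℂ)) V)
    {d : ℕ} (hd : IsSubPolarizationType (prinPeriod Z : (Fin 2 ⊕ Fin 2 → ℝ) ≃L[ℝ] (Fin 2 → ℂ)) (prinForm Z) V ![d]) :
    ∃ Y : SubtorusFrame (prinPeriod Z) 2,
      Y.realSpan.comap ((prinPeriod Z : (Fin 2 ⊕ Fin 2 → ℝ) ≃L[ℝ] (Fin 2 → ℂ)) :
        (Fin 2 ⊕ Fin 2 → ℝ) →ₗ[ℝ] (Fin 2 → ℂ)) = V ∧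
      (d : ℝ) = -prinForm Z ![latticeVec (prinPeriod Z) (Y.frame 0), latticeVec (prinPeriod Z) (Y.frame 1)] := by
  set Φ := (prinPeriod Z : (Fin 2 ⊕ Fin 2 → ℝ) ≃L[ℝ] (Fin 2 → ℂ)) with hΦ
  have hη := isRiemannForm_prinForm Z
  -- `rk(Λ ∩ V) = dim_ℝ V = 2`
  have hsub : subRank V = 2 := by
    rw [← finrank_eq_subRank hV, finrank_eq_of_isSubPolarizationType hV hd]
  -- a positively oriented frame of `Λ ∩ V`
  obtain ⟨k, eY, hpos⟩ := exists_orientationSign_subtorusPeriod_eq_one_two_mul Φ V hV hVc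
  have hk : k = 1 := by
    have h := Fintype.card_congr eY
    simp only [Fintype.card_fin] at h
    omega
  subst hk
  set Y : SubtorusFrame Φ 2 := SubtorusFrame.ofSubspace Φ V hV hVc eY hpos with hYdef
  have hW : Y.realSpan.comap (Φ : (Fin 2 ⊕ Fin 2 → ℝ) →ₗ[ℝ] (Fin 2 → ℂ)) = V := by
    rw [hYdef, SubtorusFrame.realSpan_ofSubspace]
    exact Submodule.comap_map_eq_of_injective Φ.injective V
  refine ⟨Y, hW, ?_⟩
  -- `|K(E_Z|_Y)| = d²` and `= (deg Y)²`
  have hK : Nat.card (subK Φ (prinForm Z) V) = d ^ 2 := by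
    rw [hd.natCard_subK _ hη hV hVc, Fin.prod_univ_one, Matrix.cons_val_fin_one]
  have hKdeg := natCard_subK_eq_degree_sq Z Y
  rw [hW, hK, Nat.cast_pow] at hKdeg
  obtain ⟨δ, hδ, hδeq⟩ := exists_pos_degree Z Y
  have hsq : ((d : ℝ)) ^ 2 = (δ : ℝ) ^ 2 := by rw [hKdeg, hδeq, neg_sq]
  have hdδ : (d : ℝ) = (δ : ℝ) :=
    (pow_left_inj₀ (Nat.cast_nonneg _) (by exact_mod_cast hδ.le) two_ne_zero).1 hsq
  rw [hdδ]
  exact hδeq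

/-- **IRIBAR LÓPEZ, p. 4: «when `g = 2`, `NL_{g,d}` is the Humbert surface of discriminant `d²`»** — on the period
domain `𝔥₂`, for `d ≥ 1`: `NL_{2,(d)} = N_{d²}`, the locus of PRIMITIVE singular relations of invariant `d²` (rows
A4-62/A4-65: `N_{δ²}` is Kani's locus of surfaces containing an elliptic curve of degree exactly `δ`; its image in
`𝒜₂ = Sp₄(ℤ)∖𝔥₂` is the Humbert surface `H_{d²}`). [cite: IribarLopez2024NoetherLefschetzCycles, p. 4]
[cite: BirkenhakeWilhelm2003, §4 Prop. 4.8 (p. 1830)] [cite: Kani1994EllipticCurvesAbelianSurfaces] -/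
theorem nlLocusType_two_eq_humbertLocusPrim_sq {d : ℕ} (hd : 0 < d) :
    nlLocusType 2 ![d] = humbertLocusPrim ((d : ℤ) ^ 2) := by
  have hd' : (0 : ℤ) < d := by exact_mod_cast hd
  ext Z
  rw [mem_nlLocusType_iff, mem_humbertLocusPrim_sq_iff_exists_ellipticCurve hd' Z, Int.cast_natCast]
  constructor
  · rintro ⟨V, hV, hVc, hdV⟩
    obtain ⟨Y, -, hY⟩ := exists_subtorusFrame_degree_eq_of_isSubPolarizationType Z hV hVc hdV
    exact ⟨Y, hY⟩
  · rintro ⟨Y, hY⟩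
    exact ⟨_, Y.isLatticeSubspace, Y.isComplexSubspace, isSubPolarizationType_comap_realSpan_of_degree_eq Z Y hY⟩

/-- Pointwise: `Z ∈ NL_{2,(d)}` iff `X_Z` contains an elliptic curve of degree `d` (Kani).
[cite: IribarLopez2024NoetherLefschetzCycles, p. 4] [cite: Kani1994EllipticCurvesAbelianSurfaces] -/
theorem mem_nlLocusType_two_iff_exists_ellipticCurve {d : ℕ} (Z : siegelUpperHalfSpace 2) :
    Z ∈ nlLocusType 2 ![d] ↔
      ∃ Y : SubtorusFrame (prinPeriod Z) 2,
        (d : ℝ) = -prinForm Z ![latticeVec (prinPeriod Z) (Y.frame 0), latticeVec (prinPeriod Z) (Y.frame 1)] := by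
  rw [mem_nlLocusType_iff]
  constructor
  · rintro ⟨V, hV, hVc, hdV⟩
    obtain ⟨Y, -, hY⟩ := exists_subtorusFrame_degree_eq_of_isSubPolarizationType Z hV hVc hdV
    exact ⟨Y, hY⟩
  · rintro ⟨Y, hY⟩
    exact ⟨_, Y.isLatticeSubspace, Y.isComplexSubspace, isSubPolarizationType_comap_realSpan_of_degree_eq Z Y hY⟩

/-- **`H_{d²}(𝔥₂) = ⋃_{m ∣ d} NL_{2,(m)}`** (`d ≥ 1`): a surface lies on the Humbert surface of (square) invariant
`d²` — over ALL singular relations — iff it contains an elliptic curve of some degree `m ∣ d` (row A4-62 FILE 5: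
Kani's degrees `δ′ ∣ δ`; B–W: "Obviously we have `H_Δ ⊆ H_{m²Δ}`").
[cite: BirkenhakeWilhelm2003, §4 Prop. 4.7–4.8 (p. 1830)] [cite: IribarLopez2024NoetherLefschetzCycles, p. 4] -/
theorem humbertLocusOfInvariant_sq_eq_iUnion_nlLocusType {d : ℕ} (hd : 0 < d) :
    humbertLocusOfInvariant ((d : ℤ) ^ 2) = ⋃ (m : ℕ) (_ : m ∣ d), nlLocusType 2 ![m] := by
  have hd' : (0 : ℤ) < d := by exact_mod_cast hd
  ext Z
  rw [mem_humbertLocusOfInvariant_sq_iff_exists_ellipticCurve_degree_dvd Z hd', Set.mem_iUnion₂]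
  constructor
  · rintro ⟨Y, δ', hδ', hdvd, hdeg⟩
    obtain ⟨m, rfl⟩ := Int.eq_ofNat_of_zero_le hδ'.le
    refine ⟨m, Int.natCast_dvd_natCast.1 hdvd, (mem_nlLocusType_two_iff_exists_ellipticCurve Z).2 ⟨Y, ?_⟩⟩
    rw [← hdeg, Int.cast_natCast]
  · rintro ⟨m, hmd, hZ⟩
    obtain ⟨Y, hY⟩ := (mem_nlLocusType_two_iff_exists_ellipticCurve Z).1 hZ
    have hm0 : 0 < m := Nat.pos_of_dvd_of_pos hmd hd
    refine ⟨Y, m, by exact_mod_cast hm0, Int.natCast_dvd_natCast.2 hmd, ?_⟩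
    rw [Int.cast_natCast, hY]

/-- `N_{d²} ⊆ H_{d²}(𝔥₂)` read through the gradings: `NL_{2,(d)} ⊆ H_{d²}(𝔥₂)`.
[cite: BirkenhakeWilhelm2003, §1 (∗) (p. 1819) and §4 Prop. 4.8 (p. 1830)] -/
theorem nlLocusType_two_subset_humbertLocusOfInvariant_sq {d : ℕ} (hd : 0 < d) :
    nlLocusType 2 ![d] ⊆ humbertLocusOfInvariant ((d : ℤ) ^ 2) := by
  rw [nlLocusType_two_eq_humbertLocusPrim_sq hd]
  exact humbertLocusPrim_subset_humbertLocusOfInvariant _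

/-- **Every `NL_{2,(d)}`, `d ≥ 1`, is inhabited**: Runge's model of discriminant `d² = Δ(0, d)` lies in `N_{d²}`
(`π_{0,d}(ℍ × ℍ) ⊆ N_{d²}`, row A4-65) — e.g. the surfaces `X_{π_{0,d}(τ)}` contain an elliptic curve of degree
`d`. [cite: Runge1999EndomorphismRingsAbelianSurfaces, §4 pp. 290–291] [cite: IribarLopez2024NoetherLefschetzCycles, p. 4] -/
theorem nlLocusType_two_nonempty {d : ℕ} (hd : 0 < d) : (nlLocusType 2 ![d]).Nonempty := by
  have hd0 : (d : ℤ) ≠ 0 := by exact_mod_cast hd.ne'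
  rw [nlLocusType_two_eq_humbertLocusPrim_sq hd, ← quadDisc_zero]
  exact ⟨modularEmbedding 0 d (quadDisc_zero_pos hd0) fun _ ↦ UpperHalfPlane.I,
    range_modularEmbedding_subset_humbertLocusPrim (quadDisc_zero_pos hd0) ⟨_, rfl⟩⟩

/-- Runge's model point `π_{0,d}(τ)` lies in `NL_{2,(d)}`. [cite: Runge1999EndomorphismRingsAbelianSurfaces, §4 pp. 290–291] -/
theorem modularEmbedding_zero_mem_nlLocusType_two {d : ℕ} (hd : 0 < d) (τ : Fin 2 → UpperHalfPlane) :
    modularEmbedding 0 d (quadDisc_zero_pos (by exact_mod_cast hd.ne' : (d : ℤ) ≠ 0)) τ ∈ nlLocusType 2 ![d] := by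
  rw [nlLocusType_two_eq_humbertLocusPrim_sq hd, ← quadDisc_zero]
  exact range_modularEmbedding_subset_humbertLocusPrim _ ⟨τ, rfl⟩

/-- **`NL_{2,(d)}` is closed in `𝔥₂`** (`d ≥ 1`; row A4-70: `N_Δ` is closed — local finiteness of the singular
relations of bounded invariant). [cite: BirkenhakeWilhelm2003, §4 (p. 1828)] [cite: IribarLopez2024NoetherLefschetzCycles, §1.2 ("closed and reduced subvarieties", p. 3)] -/
theorem isClosed_nlLocusType_two {d : ℕ} (hd : 0 < d) : IsClosed (nlLocusType 2 ![d]) := by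
  rw [nlLocusType_two_eq_humbertLocusPrim_sq hd]
  exact isClosed_humbertLocusPrim _

/-- **`NL_{2,(d)}` is a proper subset of `𝔥₂`** (`d ≥ 1`): it lies in `NL²_2`, whose complement (`ρ = 1`) is
dense (row A4-73). [cite: CanningOpreaPandharipande2024, §1.8 (p. 6)] [cite: IribarLopez2024NoetherLefschetzCycles, §1.2 (p. 3)] -/
theorem nlLocusType_two_ne_univ (d : ℕ) : nlLocusType 2 ![d] ≠ univ := by
  intro h
  haveI : Nonempty (siegelUpperHalfSpace 2) := ⟨pointI 2⟩
  have hsub : nlLocusType 2 ![d] ⊆ nlLocus 2 := nlLocusType_subset_nlLocus one_pos one_lt_two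
  have hc : (nlLocus 2)ᶜ = ∅ := Set.compl_empty_iff.2 (Set.eq_univ_of_univ_subset (h ▸ hsub))
  have hdense := dense_compl_nlLocus (g := 2)
  rw [hc] at hdense
  exact hdense.nonempty.ne_empty rfl

/-- **`NL_{2,(d)} = ∅ ⟺ d = 0`** (both directions of the anti-vacuity check for the graded definition at `g = 2`).
[cite: IribarLopez2024NoetherLefschetzCycles, §1.2 (p. 3) and p. 4] -/
theorem nlLocusType_two_eq_empty_iff {d : ℕ} : nlLocusType 2 ![d] = ∅ ↔ d = 0 := by
  constructor
  · intro h
    by_contra hd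
    exact (nlLocusType_two_nonempty (Nat.pos_of_ne_zero hd)).ne_empty h
  · rintro rfl
    exact nlLocusType_eq_empty_of_eq_zero 0 rfl

end Main

/-! ## §2 The principal piece: `productLocus e = NL_{2,(1)} = N_1 = H_1(𝔥₂)`; decomposable abelian surfaces -/

section Principal

/-- `(1) = (1,…,1)` with one entry. [folklore] -/
private theorem vecOne_eq_const : (![1] : Fin 1 → ℕ) = fun _ ↦ 1 := by
  funext i
  fin_cases i
  rfl

/-- **`NL_{2,(1)} = H_1(𝔥₂)`** (`= N_1`: `1` is square-free, row A4-65). [cite: IribarLopez2024NoetherLefschetzCycles, p. 4]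
[cite: BirkenhakeWilhelm2003, §4 Prop. 4.8 (`δ = 1`, p. 1830)] -/
theorem nlLocusType_two_one_eq_humbertLocusOfInvariant_one : nlLocusType 2 ![1] = humbertLocusOfInvariant 1 := by
  rw [nlLocusType_two_eq_humbertLocusPrim_sq one_pos, Nat.cast_one, one_pow,
    humbertLocusOfInvariant_one_eq_humbertLocusPrim]

/-- **THE PRODUCT LOCUS `𝒜₁ × 𝒜₁ → 𝒜₂` READ ON `𝔥₂` IS THE HUMBERT SURFACE `H_1(𝔥₂)`** (for every splitting
`e : Fin 1 ⊕ Fin 1 ≃ Fin 2`): «if `δ = (1,…,1)` then `NL_{g,δ}` is the image of the natural product map» at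
`g = 2`, `u = 1`, against B–W's «`H_1` … products of elliptic curves».
[cite: IribarLopez2024NoetherLefschetzCycles, §1.2 (p. 3) and p. 4] [cite: BirkenhakeWilhelm2003, §4 Prop. 4.8 (`δ = 1`) and Prop. 4.9 (1) (pp. 1830–1831)] -/
theorem productLocus_eq_humbertLocusOfInvariant_one (e : Fin 1 ⊕ Fin 1 ≃ Fin 2) :
    productLocus e = humbertLocusOfInvariant 1 := by
  rw [← nlLocusType_one_eq_productLocus e, ← vecOne_eq_const, nlLocusType_two_one_eq_humbertLocusOfInvariant_one]

/-- The product locus of `𝔥₂` is also `N_1` (primitive relations of invariant `1`).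
[cite: BirkenhakeWilhelm2003, §4 Prop. 4.8 (p. 1830)] [cite: HashimotoMurabayashi1995, Def. 3.6 and Prop. 2.7] -/
theorem productLocus_eq_humbertLocusPrim_one (e : Fin 1 ⊕ Fin 1 ≃ Fin 2) : productLocus e = humbertLocusPrim 1 := by
  rw [productLocus_eq_humbertLocusOfInvariant_one, humbertLocusOfInvariant_one_eq_humbertLocusPrim]

/-- **B–W Prop. 4.5 for the product locus: `Z ∈ productLocus e` iff some `γ ∈ Sp₄(ℤ)` DIAGONALISES `Z`**,
`(γ · Z)₁₂ = 0` (row A4-65 `mem_humbertLocusOfInvariant_one_iff_exists_smul_diagonal`).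
[cite: BirkenhakeWilhelm2003, §4 Prop. 4.5 and Prop. 4.8 (pp. 1828–1830)] -/
theorem mem_productLocus_iff_exists_smul_apply_eq_zero (e : Fin 1 ⊕ Fin 1 ≃ Fin 2) (Z : siegelUpperHalfSpace 2) :
    Z ∈ productLocus e ↔
      ∃ M : symplecticLatticeGroup (fun _ : Fin 2 ↦ 1),
        ((gDHom (fun _ : Fin 2 ↦ 1) principalType_pos M • Z : siegelUpperHalfSpace 2) :
          Matrix (Fin 2) (Fin 2) ℂ) 0 1 = 0 := by
  rw [productLocus_eq_humbertLocusOfInvariant_one]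
  exact mem_humbertLocusOfInvariant_one_iff_exists_smul_diagonal Z

/-- The diagonal period matrices `diag(τ₁, τ₂)` (`E_{τ₁} × E_{τ₂}`) lie in the product locus (row A4-64
`diagPoint_mem_humbertLocusOfInvariant_one`). [cite: BirkenhakeWilhelm2003, §4 Prop. 4.8 (p. 1830)]
[cite: Lange2023AbelianVarietiesComplex, §3.1.1] -/
theorem diagPoint_mem_productLocus (e : Fin 1 ⊕ Fin 1 ≃ Fin 2) (τ : Fin 2 → UpperHalfPlane) :
    diagPoint τ ∈ productLocus e := by
  rw [productLocus_eq_humbertLocusOfInvariant_one]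
  exact diagPoint_mem_humbertLocusOfInvariant_one τ

/-- A period matrix with `z₁₂ = 0` lies in the product locus. [cite: BirkenhakeWilhelm2003, §4 Prop. 4.8 (p. 1830)] -/
theorem mem_productLocus_of_apply_eq_zero (e : Fin 1 ⊕ Fin 1 ≃ Fin 2) (Z : siegelUpperHalfSpace 2)
    (h : (Z : Matrix (Fin 2) (Fin 2) ℂ) 0 1 = 0) : Z ∈ productLocus e := by
  rw [productLocus_eq_humbertLocusOfInvariant_one, ← one_pow 2]
  exact mem_humbertLocusOfInvariant_one_of_apply_eq_zero Z h

/-- **COP §2.2 AT `g = 2`: a principally polarised abelian surface `(X_Z, E_Z)` is DECOMPOSABLE — a polarised product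
of two elliptic curves — iff `Z ∈ H_1(𝔥₂)`** (FILE 1 `isPolarizedDecomposable_prinPeriod_iff` / FILE 2
`isPolarizedDecomposable_iff_exists_mem_nlLocusType_one`: the only splitting is `2 = 1 + 1`).
[cite: CanningOpreaPandharipande2024, §2.2 (p. 8)] [cite: BirkenhakeWilhelm2003, §4 Prop. 4.8 (`δ = 1`) and Prop. 4.9 (1) (pp. 1830–1831)]
[cite: Lange2023AbelianVarietiesComplex, §2.4.4 Cor. 2.4.31 (p. 125)] -/
theorem isPolarizedDecomposable_prinPeriod_iff_mem_humbertLocusOfInvariant_one (Z : siegelUpperHalfSpace 2) :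
    IsPolarizedDecomposable (prinPeriod Z : (Fin 2 ⊕ Fin 2 → ℝ) ≃L[ℝ] (Fin 2 → ℂ)) (prinForm Z) ↔
      Z ∈ humbertLocusOfInvariant 1 := by
  rw [isPolarizedDecomposable_iff_exists_mem_nlLocusType_one]
  constructor
  · rintro ⟨u, hu0, hu2, hZ⟩
    obtain rfl : u = 1 := by omega
    rwa [← vecOne_eq_const, nlLocusType_two_one_eq_humbertLocusOfInvariant_one] at hZ
  · intro hZ
    refine ⟨1, one_pos, one_lt_two, ?_⟩
    rwa [← vecOne_eq_const, nlLocusType_two_one_eq_humbertLocusOfInvariant_one]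

/-- **`E_{τ₁} × E_{τ₂}` with its product principal polarisation is decomposable** (the diagonal period matrices).
[cite: CanningOpreaPandharipande2024, §2.2 (p. 8)] [cite: Lange2023AbelianVarietiesComplex, §3.1.1] -/
theorem isPolarizedDecomposable_diagPoint (τ : Fin 2 → UpperHalfPlane) :
    IsPolarizedDecomposable (prinPeriod (diagPoint τ) : (Fin 2 ⊕ Fin 2 → ℝ) ≃L[ℝ] (Fin 2 → ℂ))
      (prinForm (diagPoint τ)) :=
  (isPolarizedDecomposable_prinPeriod_iff_mem_humbertLocusOfInvariant_one _).2
    (diagPoint_mem_humbertLocusOfInvariant_one τ)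

/-- A decomposable abelian surface is the `Sp₄(ℤ)`-translate of a diagonal period matrix.
[cite: BirkenhakeWilhelm2003, §4 Prop. 4.5 and Prop. 4.8 (pp. 1828–1830)] [cite: CanningOpreaPandharipande2024, §2.2 (p. 8)] -/
theorem isPolarizedDecomposable_prinPeriod_iff_exists_smul_apply_eq_zero (Z : siegelUpperHalfSpace 2) :
    IsPolarizedDecomposable (prinPeriod Z : (Fin 2 ⊕ Fin 2 → ℝ) ≃L[ℝ] (Fin 2 → ℂ)) (prinForm Z) ↔
      ∃ M : symplecticLatticeGroup (fun _ : Fin 2 ↦ 1),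
        ((gDHom (fun _ : Fin 2 ↦ 1) principalType_pos M • Z : siegelUpperHalfSpace 2) :
          Matrix (Fin 2) (Fin 2) ℂ) 0 1 = 0 := by
  rw [isPolarizedDecomposable_prinPeriod_iff_mem_humbertLocusOfInvariant_one]
  exact mem_humbertLocusOfInvariant_one_iff_exists_smul_diagonal Z

/-- **`H_1(𝔥₂) ≠ 𝔥₂`**: the very general principally polarised abelian surface is NOT a product of elliptic
curves (FILE 2 `productLocus_ne_univ`; `ρ = 1` off `NL²_2`). [cite: CanningOpreaPandharipande2024, §1.8 (p. 6)]
[cite: BirkenhakeWilhelm2003, §4 Prop. 4.9 (1) (p. 1831)] -/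
theorem humbertLocusOfInvariant_one_ne_univ : humbertLocusOfInvariant 1 ≠ univ := by
  rw [← productLocus_eq_humbertLocusOfInvariant_one finSumFinEquiv]
  exact productLocus_ne_univ one_pos one_pos

/-- `H_1(𝔥₂)` is inhabited and proper (anti-vacuity, both directions). [cite: BirkenhakeWilhelm2003, §4 Prop. 4.8–4.9 (pp. 1830–1831)] -/
theorem humbertLocusOfInvariant_one_nonempty_and_ne_univ :
    (humbertLocusOfInvariant 1).Nonempty ∧ humbertLocusOfInvariant 1 ≠ univ :=
  ⟨⟨_, diagPoint_mem_humbertLocusOfInvariant_one fun _ ↦ UpperHalfPlane.I⟩, humbertLocusOfInvariant_one_ne_univ⟩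

end Principal

end SiegelModuli

end Literature.AlgebraicGeometry.ModuliOfAbelianVarieties

end
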